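import Summits.CriticalPhenomena.PercolationContinuityZ3.Theorems.PercNearOneGluingNoHeavyLowerTailKnQuestion8CoefficientwiseOneSidedDomination
import Summits.CriticalPhenomena.PercolationContinuityZ3.Theorems.PercNearOneGluingNoHeavyLowerTailKnQuestion8CoefficientwiseHarrisTwice
import HarnessLib

/-!
# The flip–Harris cell tool and LEMMA S′: `Σ_{x ∉ C_u, y ∈ C_u ∩ K̄} (g(K̄ ∪ B_u) − g(K)) ≥ 0` — prim-lf-2 gen 53 (part 5)

Support file (`--supports stmt-CriticalPhenomena-4575`, closed), prover `prim-lf-2` (gen 53).  No definitions, no named facts, no sorries; standard axioms.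
Memo `prim-lf-2/CW-SERIES-gen53.md` §7.4.  Setting as in parts 1–4: finite multigraph `ends : ι → Sym2 V`, root `x`, `K(s) = openCluster (ends '' s) x`, `K̄ = K(sᶜ)`; for a vertex `u`,
`C_u(s)` its red cluster and `B_u(s) = C_u(sᶜ)` its blue cluster.
* `cell_pairing_harris` — TOOL: on a cell `{t | t ∩ B = π}` with free flip `τ t = π ∪ (tᶜ ∖ B)`: if `c ≥ 0`, `G` is antitone, `t ↦ c t − c (τ t)` is antitone and `F t ≤ G (τ t)` on the cell,
  then `0 ≤ Σ_{cell} c·(G − F)`.  (Reindex `Σ c·G∘τ = Σ c∘τ·G` and apply FKG on the cell to the two antitone functions `c − c∘τ` (cell-mean zero) and `G`.)  This 'Harris on c − c∘τ' step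
  signs one-condition cell sums whose comparison set `G` is larger than the flip image — where gen 29's `cell_sum_le_flip` + FKG (`offCluster_domination_cond`, part 1) does not apply.
* `flipHarris_twoSided_nonneg` — **LEMMA S′ (prim-lf-2 gen 53, §7.4):** for all `u, y` and monotone `g`,
  `0 ≤ Σ_{s : x ∉ C_u s, y ∈ C_u s, y ∈ K̄ s} (g(K̄ s ∪ B_u s) − g(K s))`.  Cells of the red cluster of `u` (x outside, y inside), then the tool with `c = [y ∈ K̄]`, `G = g(K̄ ∪ B_u)`, `F = g∘K`.
Role: with the root-edge identity (part 3) `½NO-CORE^{G}(y)[1_u] = T₁₁ + S_{D2} + ½NO-CORE^{G−xu}(y)[1_u]` for a root-adjacent point `u`, LEMMA S′ = `S_{D2} + X` with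
`X = Σ_{u ∈ K̄∖K, y ∈ C_u ∩ K̄}(g(K̄) − g(K)) ≥ 0`; the remaining unsigned piece of CONJECTURE NO-CORE at root-adjacent points is `S_{D2}` alone (census-clean on all graphs with ≤ 7 vertices,
prim-lf-2 kit j211265/267/269), which is NOT cell-positive — see the memo.
[cite: KozmaNitzan2024, Questions 8–9 (§5.5 p. 36) (context: the Question-8 pocket covariance programme)]
-/

namespace Summit.CriticalPhenomena.PercolationContinuityZ3.Theorems

open Finset Literature.Probability.Percolation

namespace Coefficientwise

variable {ι V : Type*} [Fintype ι] [DecidableEq ι]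

/-- **Flip–Harris cell tool.**  On the cell `{t | t ∩ B = π}` (`π ⊆ B`) with the free flip `τ t = π ∪ (tᶜ ∖ B)`: for `c ≥ 0`, `G` antitone, `t ↦ c t − c (τ t)` antitone and
`F t ≤ G (τ t)` on the cell, `0 ≤ Σ_{cell} c t · (G t − F t)`.  [cite: KozmaNitzan2024, §5.5 (context only; the inequality is FKG on a sublattice)] -/
theorem cell_pairing_harris (B π : Finset ι) (hπ : π ⊆ B) (c F G : Finset ι → ℝ) (hc0 : ∀ t, 0 ≤ c t) (hG : Antitone G)
    (hh : Antitone (fun t => c t - c (π ∪ (tᶜ \ B))))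
    (hFG : ∀ t : Finset ι, t ∩ B = π → F t ≤ G (π ∪ (tᶜ \ B))) :
    0 ≤ ∑ t ∈ univ.filter (fun t : Finset ι => t ∩ B = π), c t * (G t - F t) := by
  set cell := univ.filter (fun t : Finset ι => t ∩ B = π) with hcell
  have mem_cell : ∀ t : Finset ι, t ∈ cell ↔ t ∩ B = π := fun t => by simp [hcell]
  set τ : Finset ι → Finset ι := fun t => π ∪ (tᶜ \ B) with hτ
  have facts : ∀ t : Finset ι, t ∩ B = π → ∀ i, (i ∈ π ↔ i ∈ t ∧ i ∈ B) := fun t ht i => by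
    rw [← ht]; exact Finset.mem_inter
  have memτ : ∀ t i, i ∈ τ t ↔ i ∈ π ∨ (i ∉ t ∧ i ∉ B) := fun t i => by
    simp only [hτ, Finset.mem_union, Finset.mem_sdiff, Finset.mem_compl]
  have hτcell : ∀ t, t ∩ B = π → τ t ∩ B = π := by
    intro t ht; ext i; simp only [Finset.mem_inter, memτ]
    have h1 := facts t ht i; have h2 : i ∈ π → i ∈ B := fun h => hπ h; tauto
  have hττ : ∀ t, t ∩ B = π → τ (τ t) = t := by
    intro t ht; ext i; rw [memτ, memτ]
    have h1 := facts t ht i; have h2 : i ∈ π → i ∈ B := fun h => hπ h; tauto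
  -- step 1: F ≤ G∘τ termwise (with the nonnegative weight c)
  have step1 : ∑ t ∈ cell, c t * F t ≤ ∑ t ∈ cell, c t * G (τ t) :=
    Finset.sum_le_sum fun t ht => mul_le_mul_of_nonneg_left (hFG t ((mem_cell t).mp ht)) (hc0 t)
  -- step 2: reindex by τ
  have step2 : ∑ t ∈ cell, c t * G (τ t) = ∑ t ∈ cell, c (τ t) * G t := by
    refine Finset.sum_bij' (fun t _ => τ t) (fun t _ => τ t) ?_ ?_ ?_ ?_ ?_
    · intro t ht; exact (mem_cell _).mpr (hτcell t ((mem_cell t).mp ht))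
    · intro t ht; exact (mem_cell _).mpr (hτcell t ((mem_cell t).mp ht))
    · intro t ht; exact hττ t ((mem_cell t).mp ht)
    · intro t ht; exact hττ t ((mem_cell t).mp ht)
    · intro t ht; rw [hττ t ((mem_cell t).mp ht)]
  -- step 3: FKG on the cell for the antitone functions `c − c∘τ` (cell-mean zero) and `G`
  have hsum0 : ∑ t ∈ cell, (c t - c (τ t)) = 0 := by
    rw [Finset.sum_sub_distrib]
    have : ∑ t ∈ cell, c (τ t) = ∑ t ∈ cell, c t := by
      refine Finset.sum_bij' (fun t _ => τ t) (fun t _ => τ t) ?_ ?_ ?_ ?_ ?_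
      · intro t ht; exact (mem_cell _).mpr (hτcell t ((mem_cell t).mp ht))
      · intro t ht; exact (mem_cell _).mpr (hτcell t ((mem_cell t).mp ht))
      · intro t ht; exact hττ t ((mem_cell t).mp ht)
      · intro t ht; exact hττ t ((mem_cell t).mp ht)
      · intro t ht; rfl
    rw [this]; ring
  have hfkg := fkg_cell B π (fun t => -(c t - c (τ t))) (fun t => -G t)
    (fun s t hst => by have := hh hst; simp only [neg_le_neg_iff]; exact this)
    (fun s t hst => by have := hG hst; simp only [neg_le_neg_iff]; exact this)
  have e1 : ∑ t ∈ cell, -(c t - c (τ t)) = 0 := by rw [Finset.sum_neg_distrib, hsum0, neg_zero]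
  have e2 : ∑ t ∈ cell, (-(c t - c (τ t))) * (-G t) = ∑ t ∈ cell, (c t - c (τ t)) * G t :=
    Finset.sum_congr rfl fun t _ => by ring
  change (∑ t ∈ cell, -(c t - c (τ t))) * (∑ t ∈ cell, -G t) ≤ (cell.card : ℝ) * ∑ t ∈ cell, (-(c t - c (τ t))) * (-G t) at hfkg
  rw [e1, zero_mul, e2] at hfkg
  have step3 : 0 ≤ ∑ t ∈ cell, (c t - c (τ t)) * G t := by
    rcases Nat.eq_zero_or_pos cell.card with h0 | hpos
    · rw [Finset.card_eq_zero.mp h0, Finset.sum_empty]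
    · have hc : (0 : ℝ) < (cell.card : ℝ) := by exact_mod_cast hpos
      exact nonneg_of_mul_nonneg_right (by linarith [hfkg]) hc |> fun h => by nlinarith [hfkg, hc]
  -- combine
  have : ∑ t ∈ cell, c t * (G t - F t) = ∑ t ∈ cell, c t * G t - ∑ t ∈ cell, c t * F t := by
    rw [← Finset.sum_sub_distrib]; exact Finset.sum_congr rfl fun t _ => by ring
  rw [this]
  have h4 : ∑ t ∈ cell, (c t - c (τ t)) * G t = ∑ t ∈ cell, c t * G t - ∑ t ∈ cell, c (τ t) * G t := by
    rw [← Finset.sum_sub_distrib]; exact Finset.sum_congr rfl fun t _ => by ring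
  linarith [step1, step2, step3, h4]

variable (ends : ι → Sym2 V) (x : V)

open Classical in
/-- **LEMMA S′ (prim-lf-2 gen 53).**  For a finite multigraph, a root `x`, vertices `u, y` and a monotone `g`, with `K = C_x`, `K̄ s = K sᶜ`, `C_u` / `B_u` the red / blue cluster of `u`:
`0 ≤ Σ_{s : x ∉ C_u s, y ∈ C_u s, y ∈ K̄ s} (g(K̄ s ∪ B_u s) − g(K s))`.  (Cells of the red cluster of `u` + `cell_pairing_harris` with `c = [y ∈ K̄]`.)
[cite: KozmaNitzan2024, Questions 8–9 (§5.5 p. 36) (context)] -/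
theorem flipHarris_twoSided_nonneg (u y : V) (g : Set V → ℝ) (hg : Monotone g) :
    0 ≤ ∑ s ∈ univ.filter (fun s : Finset ι => x ∉ openCluster (ends '' (↑s : Set ι)) u ∧ y ∈ openCluster (ends '' (↑s : Set ι)) u ∧
        y ∈ openCluster (ends '' (↑(sᶜ) : Set ι)) x),
      (g (openCluster (ends '' (↑(sᶜ) : Set ι)) x ∪ openCluster (ends '' (↑(sᶜ) : Set ι)) u) - g (openCluster (ends '' (↑s : Set ι)) x)) := by
  -- notation
  set K : Finset ι → Set V := fun s => openCluster (ends '' (↑s : Set ι)) x with hK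
  set F : Finset ι → ℝ := fun s => g (K s) with hF
  set R : Finset ι → Set V := fun s => openCluster (ends '' (↑s : Set ι)) u with hR
  set Ub : Finset ι → Set V := fun s => openCluster (ends '' (↑(sᶜ) : Set ι)) u with hUb
  set G : Finset ι → ℝ := fun s => g (K sᶜ ∪ Ub s) with hGdef
  set c : Finset ι → ℝ := fun s => if y ∈ K sᶜ then (1 : ℝ) else 0 with hc
  set D : Finset (Finset ι) := univ.filter (fun s : Finset ι => x ∉ R s ∧ y ∈ R s) with hD
  -- rewrite the target as a weighted sum over `D`
  have htarget : ∑ s ∈ univ.filter (fun s : Finset ι => x ∉ R s ∧ y ∈ R s ∧ y ∈ K sᶜ), (G s - F s) = ∑ s ∈ D, c s * (G s - F s) := by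
    rw [Finset.sum_filter, Finset.sum_filter]
    refine Finset.sum_congr rfl fun s _ => ?_
    by_cases h1 : (x ∉ R s ∧ y ∈ R s)
    · by_cases h2 : y ∈ K sᶜ
      · rw [if_pos ⟨h1.1, h1.2, h2⟩, if_pos h1]; simp only [hc, if_pos h2]; ring
      · have : ¬ (x ∉ R s ∧ y ∈ R s ∧ y ∈ K sᶜ) := fun h => h2 h.2.2
        rw [if_neg this, if_pos h1]; simp only [hc, if_neg h2]; ring
    · have : ¬ (x ∉ R s ∧ y ∈ R s ∧ y ∈ K sᶜ) := fun h => h1 ⟨h.1, h.2.1⟩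
      rw [if_neg this, if_neg h1]
  change 0 ≤ ∑ s ∈ univ.filter (fun s : Finset ι => x ∉ R s ∧ y ∈ R s ∧ y ∈ K sᶜ), (G s - F s)
  rw [htarget]
  have hKmono : ∀ {s t : Finset ι}, s ⊆ t → K s ⊆ K t := fun hst => openCluster_image_mono ends hst x
  have hFm : Monotone F := fun s t hst => hg (hKmono hst)
  -- the edges at a vertex set, and the cell key
  set I : Set V → Finset ι := fun S => univ.filter (fun i : ι => ∃ v ∈ S, v ∈ ends i) with hI
  set key : Finset ι → Set V × Finset ι := fun s => (R s, s ∩ I (R s)) with hkey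
  have R_closed : ∀ (s : Finset ι) {u w : V}, u ∈ R s → (openGraph (ends '' (↑s : Set ι))).Adj u w → w ∈ R s := by
    intro s u w hu hadj
    exact SimpleGraph.Reachable.trans hu hadj.reachable
  have mem_I : ∀ (S : Set V) (i : ι) (v : V), v ∈ S → v ∈ ends i → i ∈ I S := by
    intro S i v hv hvi
    simp only [hI, Finset.mem_filter, Finset.mem_univ, true_and]
    exact ⟨v, hv, hvi⟩
  have p_mem_R : ∀ (s : Finset ι), u ∈ R s := fun s => mem_openCluster_self _ u
  -- locality: a configuration agreeing with `s₀` on the edges at `R s₀` has the same red cluster of `u`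
  have locality : ∀ s₀ t : Finset ι, t ∩ I (R s₀) = s₀ ∩ I (R s₀) → R t = R s₀ := by
    intro s₀ t ht
    have agree : ∀ i, i ∈ I (R s₀) → (i ∈ t ↔ i ∈ s₀) := by
      intro i hi
      have := congrArg (fun u : Finset ι => i ∈ u) ht
      simp only [Finset.mem_inter, hi, and_true, eq_iff_iff] at this
      exact this
    have h1 : ∀ u ∈ R s₀, ∀ w, (openGraph (ends '' (↑s₀ : Set ι))).Adj u w →
        (openGraph (ends '' (↑t : Set ι))).Adj u w ∧ w ∈ R s₀ := by
      intro u hu w hadj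
      refine ⟨?_, R_closed s₀ hu hadj⟩
      rw [openGraph_image_adj] at hadj ⊢
      obtain ⟨⟨i, his, hi⟩, hne⟩ := hadj
      have hiI : i ∈ I (R s₀) := mem_I _ i u hu (by rw [hi]; exact Sym2.mem_mk_left u w)
      exact ⟨⟨i, (agree i hiI).mpr his, hi⟩, hne⟩
    have h2 : ∀ u ∈ R s₀, ∀ w, (openGraph (ends '' (↑t : Set ι))).Adj u w →
        (openGraph (ends '' (↑s₀ : Set ι))).Adj u w ∧ w ∈ R s₀ := by
      intro u hu w hadj
      have hadj' : (openGraph (ends '' (↑s₀ : Set ι))).Adj u w := by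
        rw [openGraph_image_adj] at hadj ⊢
        obtain ⟨⟨i, hit, hi⟩, hne⟩ := hadj
        have hiI : i ∈ I (R s₀) := mem_I _ i u hu (by rw [hi]; exact Sym2.mem_mk_left u w)
        exact ⟨⟨i, (agree i hiI).mp hit, hi⟩, hne⟩
      exact ⟨hadj', R_closed s₀ hu hadj'⟩
    ext y
    constructor
    · intro hy
      obtain ⟨q⟩ := hy
      exact ((reachable_transfer (R s₀) h2 q) (p_mem_R s₀)).2
    · intro hy
      obtain ⟨q⟩ := hy
      exact ((reachable_transfer (R s₀) h1 q) (p_mem_R s₀)).1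
  -- split the sum over `D` along the fibres of `key`
  rw [← Finset.sum_fiberwise_of_maps_to (s := D) (t := D.image key) (g := key)
    (fun s hs => Finset.mem_image_of_mem key hs)]
  refine Finset.sum_nonneg fun k hk => ?_
  obtain ⟨s₀, hs₀D, rfl⟩ := Finset.mem_image.mp hk
  obtain ⟨hxs₀, hWs₀⟩ := (Finset.mem_filter.mp hs₀D).2
  set S₀ : Set V := R s₀ with hS₀
  set B : Finset ι := I S₀ with hB
  set π : Finset ι := s₀ ∩ B with hπ
  have hxS₀ : x ∉ S₀ := hxs₀
  -- the fibre of `key s₀` in `D` is exactly the cell `{t | t ∩ B = π}`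
  have fiber_eq : D.filter (fun t => key t = key s₀) = univ.filter (fun t : Finset ι => t ∩ B = π) := by
    ext t
    simp only [Finset.mem_filter, Finset.mem_univ, true_and]
    constructor
    · rintro ⟨_, hkt⟩
      have h1 : R t = S₀ := (Prod.ext_iff.mp hkt).1
      have h2 : t ∩ I (R t) = s₀ ∩ I (R s₀) := (Prod.ext_iff.mp hkt).2
      rw [h1] at h2
      exact h2
    · intro ht
      have hRt : R t = S₀ := locality s₀ t ht
      refine ⟨?_, ?_⟩
      · rw [hD, Finset.mem_filter]
        refine ⟨Finset.mem_univ _, ?_, ?_⟩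
        · rw [hRt]; exact hxS₀
        · rw [hRt]; exact hWs₀
      · change (R t, t ∩ I (R t)) = (R s₀, s₀ ∩ I (R s₀))
        rw [hRt]
        exact Prod.ext rfl ht
  rw [fiber_eq]
  set cell : Finset (Finset ι) := univ.filter (fun t : Finset ι => t ∩ B = π) with hcell
  -- on the cell, the red cluster of `x` uses no edge at `S₀`
  have offcluster : ∀ t : Finset ι, t ∩ B = π → K t ⊆ K ((B \ π) ∪ (t \ B)) := by
    intro t ht
    have agree : ∀ i, i ∈ B → (i ∈ t ↔ i ∈ s₀) := by
      intro i hi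
      have := congrArg (fun u : Finset ι => i ∈ u) ht
      simp only [hπ, Finset.mem_inter, hi, and_true, eq_iff_iff] at this
      exact this
    have htr : ∀ u ∈ S₀ᶜ, ∀ w, (openGraph (ends '' (↑t : Set ι))).Adj u w →
        (openGraph (ends '' (↑(t \ B) : Set ι))).Adj u w ∧ w ∈ S₀ᶜ := by
      intro u hu w hadj
      rw [openGraph_image_adj] at hadj
      obtain ⟨⟨i, hit, hi⟩, hne⟩ := hadj
      have hiB : i ∉ B := by
        intro hiB
        have his₀ : i ∈ s₀ := (agree i hiB).mp hit
        have hiB' := hiB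
        simp only [hB, hI, Finset.mem_filter, Finset.mem_univ, true_and] at hiB'
        obtain ⟨v, hvS, hvi⟩ := hiB'
        rw [hi, Sym2.mem_iff] at hvi
        rcases hvi with rfl | rfl
        · exact hu hvS
        · have hadj₀ : (openGraph (ends '' (↑s₀ : Set ι))).Adj v u := by
            rw [openGraph_image_adj]
            exact ⟨⟨i, his₀, by rw [hi, Sym2.eq_swap]⟩, hne.symm⟩
          exact hu (R_closed s₀ hvS hadj₀)
      have hwS : w ∈ S₀ᶜ := by
        intro hwS
        exact hiB (mem_I S₀ i w hwS (by rw [hi]; exact Sym2.mem_mk_right u w))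
      refine ⟨?_, hwS⟩
      rw [openGraph_image_adj]
      exact ⟨⟨i, Finset.mem_sdiff.mpr ⟨hit, hiB⟩, hi⟩, hne⟩
    intro y hy
    obtain ⟨q⟩ := hy
    have hreach := ((reachable_transfer S₀ᶜ htr q) hxS₀).1
    exact hKmono Finset.subset_union_right hreach
  -- apply the flip–Harris tool on the cell
  have hcompl_flip : ∀ t : Finset ι, t ∩ B = π → (π ∪ (tᶜ \ B))ᶜ = (B \ π) ∪ (t \ B) := by
    intro t ht; ext i
    simp only [Finset.mem_compl, Finset.mem_union, Finset.mem_sdiff]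
    have h1 : i ∈ π ↔ i ∈ t ∧ i ∈ B := by rw [← ht]; exact Finset.mem_inter
    have h2 : i ∈ π → i ∈ B := fun h => Finset.inter_subset_right (hπ ▸ h)
    tauto
  refine cell_pairing_harris B π Finset.inter_subset_right c F G (fun t => by simp only [hc]; split_ifs <;> norm_num) ?_ ?_ ?_
  · -- G antitone
    intro s t hst
    have h1 : K tᶜ ⊆ K sᶜ := hKmono (compl_subset_compl.mpr hst)
    have h2 : Ub t ⊆ Ub s := openCluster_image_mono ends (compl_subset_compl.mpr hst) u
    exact hg (Set.union_subset_union h1 h2)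
  · -- c − c∘τ antitone: c antitone, c∘τ monotone
    intro s t hst
    have hcs : c t ≤ c s := by
      simp only [hc]
      by_cases h : y ∈ K tᶜ
      · have : y ∈ K sᶜ := hKmono (compl_subset_compl.mpr hst) h
        rw [if_pos h, if_pos this]
      · rw [if_neg h]; split_ifs <;> norm_num
    have hτs : c (π ∪ (sᶜ \ B)) ≤ c (π ∪ (tᶜ \ B)) := by
      have hsub : (π ∪ (sᶜ \ B))ᶜ ⊆ (π ∪ (tᶜ \ B))ᶜ := by
        refine compl_subset_compl.mpr (Finset.union_subset_union (le_refl π) ?_)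
        exact Finset.sdiff_subset_sdiff (compl_subset_compl.mpr hst) (le_refl B)
      simp only [hc]
      by_cases h : y ∈ K (π ∪ (sᶜ \ B))ᶜ
      · have : y ∈ K (π ∪ (tᶜ \ B))ᶜ := hKmono hsub h
        rw [if_pos h, if_pos this]
      · rw [if_neg h]; split_ifs <;> norm_num
    simp only
    linarith
  · -- F t ≤ G (τ t) on the cell: K t ⊆ K̄ (τ t) = K ((B ∖ π) ∪ (t ∖ B))
    intro t ht
    have h1 : K t ⊆ K (π ∪ (tᶜ \ B))ᶜ := by rw [hcompl_flip t ht]; exact offcluster t ht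
    exact hg (h1.trans Set.subset_union_left)

end Coefficientwise

end Summit.CriticalPhenomena.PercolationContinuityZ3.Theorems
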